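import Summits.CriticalPhenomena.PercolationContinuityZ3.Theorems.Transplant.FKConnectivityAllQPat3TheoremSPMinor
import Summits.CriticalPhenomena.PercolationContinuityZ3.Theorems.Transplant.FKConnectivityAllQSPTwoTreeBridge
import HarnessLib

/-!
# Connectivity correlation inequalities for `φ_{w,q}`, every `q > 0` — **`δ ≥ 0` AND THE HUB INEQUALITY FOR EVERY PLACEMENT ON TWO-TERMINAL SERIES–PARALLEL AND 2-TREE SUPPORTS**

Proof file (`--supports stmt-CriticalPhenomena-4575`), census lineage (gen 37) of LANE 2's FK sub-programme; builds on p205010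
(kernel theorem, internal audit signed; external expert review pending).  No definitions, no named facts, no sorries.

The MEASURE-LEVEL consequence of census g37's THEOREM SP on minors (`FK.antipodalT_nonneg_of_isTTSP_minor`,
`…Pat3TheoremSPMinor.lean`) through the local form of `…Pat3SPConjecture.lean` / `…DeltaSupport.lean` (`FK.hubUnder_of_spGood_support`: SP-goodness of the
minors of the support suffices).  RESULTS, for every `q > 0` and every weight vector
`w` supported in a two-terminal series–parallel network `N`: for pairwise distinct `b, s, t` on `N` — `δ_w(b; s, t) ≥ 0`
(`FK.deltaMass_nonneg_of_isTTSP_marks`), the HUB INEQUALITY ALR (13)/(14) `φ(b ↔ s)·φ(t ↔ s) ≤ φ(b ↔ s ↔ t)`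
(`FK.hubUnder_of_isTTSP_marks`) and the sharper correlation of `{s ↔ t}` with `{b ↔ s} ∪ {b ↔ t}`
(`FK.real_conn_union_le_of_isTTSP_marks`); and for ALL triples `o, a, b : V` (degenerate ones via `…DeltaSupport.lean`) —
`FK.hubUnder_of_isTTSP_support`, `FK.hubFK_of_isTTSP_support` (`HubFK q`'s clause verbatim on TTSP supports),
`FK.real_conn_union_le_of_isTTSP_support`, and through fk-2's bridge `FK.IsTTSP.of_isTwoTree` the same on 2-TREE supports,
`FK.hubUnder_of_isTwoTree_support`, superseding the placement hypotheses `oa, ba ∈ T` of `FK.hubUnder_of_isTwoTree` (`q < 1`)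
and `FK.hubUnder_of_isTwoTree_of_pos` (the tree's hub rows on series–parallel supports, like `FK.hubUnder_of_isTTSP`, need the two
pairs completable inside the class; example newly covered: `K_{2,3}` with the hub and both other marks on the side of size three).
[cite: AyyerLinussonRavichandran2025, §7 eq. (13)–(15), Conj. 7.1 (p. 22)] [cite: Grimmett2006, §3.8 (pp. 61–62); §3.9 (p. 63)]
-/

namespace Summit.CriticalPhenomena.PercolationContinuityZ3.Theorems

namespace FK

open MeasureTheory Set Literature.Probability.LatticeModels Literature.Probability.Percolation
open scoped Classical

variable {V : Type*} [Fintype V] (w : Sym2 V → unitInterval)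

/-! ### Distinct marks on the support -/

/-- **NEW KERNEL ROW (census g37): `δ_w(b; s, t) ≥ 0` FOR EVERY WEIGHT VECTOR SUPPORTED IN A TWO-TERMINAL SERIES–PARALLEL NETWORK
AND EVERY THREE DISTINCT MARKS ON IT, every `q > 0`.** [cite: AyyerLinussonRavichandran2025, §7 eq. (13)–(15) (p. 22)] -/
theorem deltaMass_nonneg_of_isTTSP_marks {q : ℝ} (hq : 0 < q) {N : Finset (Sym2 V)} {x y b s t : V} (hN : IsTTSP N x y)
    (hw : ∀ e, ((w e : unitInterval) : ℝ) ≠ 0 → e ∈ (↑N : Set (Sym2 V)))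
    (hb : ∃ e ∈ N, b ∈ e) (hs : ∃ e ∈ N, s ∈ e) (ht : ∃ e ∈ N, t ∈ e) (hbs : b ≠ s) (hbt : b ≠ t) (hst : s ≠ t) :
    0 ≤ deltaMass w q b s t :=
  deltaMass_nonneg_of_spGood_support w hq (fun _ _ hE hC _ _ _ => spGoodC_of_isTTSP hN hE hC) hw hb hs ht hbs hbt hst

/-- **THE HUB INEQUALITY ALR (13)/(14) FOR EVERY PLACEMENT OF DISTINCT MARKS ON A TWO-TERMINAL SERIES–PARALLEL SUPPORT, every
`q > 0`**: `φ(b ↔ s)·φ(t ↔ s) ≤ φ(b ↔ s ↔ t)` (`FK.HubUnder`; hub `s`).  UNCONDITIONAL; the pairs `bs`, `ts` need NOT be completable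
to two-terminal presentations (cf. `FK.hubUnder_of_isTTSP`). [cite: AyyerLinussonRavichandran2025, §7 eq. (13)–(14), Conj. 7.1 (p. 22)] -/
theorem hubUnder_of_isTTSP_marks {q : ℝ} (hq : 0 < q) {N : Finset (Sym2 V)} {x y b s t : V} (hN : IsTTSP N x y)
    (hw : ∀ e, ((w e : unitInterval) : ℝ) ≠ 0 → e ∈ (↑N : Set (Sym2 V)))
    (hb : ∃ e ∈ N, b ∈ e) (hs : ∃ e ∈ N, s ∈ e) (ht : ∃ e ∈ N, t ∈ e) (hbs : b ≠ s) (hbt : b ≠ t) (hst : s ≠ t) :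
    HubUnder (rcMeasureW w q ∅) b s t :=
  hubUnder_of_deltaMass_nonneg w hq (deltaMass_nonneg_of_isTTSP_marks w hq hN hw hb hs ht hbs hbt hst)

/-- **The sharper correlation on two-terminal series–parallel supports, distinct marks, every `q > 0`**:
`φ(s ↔ t)·φ(b ↔ {s,t}) ≤ φ(Ω)·φ(s ↔ t, b ↔ {s,t})`. [cite: AyyerLinussonRavichandran2025, §7 (p. 22)] -/
theorem real_conn_union_le_of_isTTSP_marks {q : ℝ} (hq : 0 < q) {N : Finset (Sym2 V)} {x y b s t : V} (hN : IsTTSP N x y)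
    (hw : ∀ e, ((w e : unitInterval) : ℝ) ≠ 0 → e ∈ (↑N : Set (Sym2 V)))
    (hb : ∃ e ∈ N, b ∈ e) (hs : ∃ e ∈ N, s ∈ e) (ht : ∃ e ∈ N, t ∈ e) (hbs : b ≠ s) (hbt : b ≠ t) (hst : s ≠ t) :
    (rcMeasureW w q ∅).real (openConn s t) * (rcMeasureW w q ∅).real (openConn b s ∪ openConn b t) ≤
      (rcMeasureW w q ∅).real univ * (rcMeasureW w q ∅).real (openConn s t ∩ (openConn b s ∪ openConn b t)) :=
  real_conn_union_le_of_deltaMass_nonneg w hq (deltaMass_nonneg_of_isTTSP_marks w hq hN hw hb hs ht hbs hbt hst)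

/-! ### All triples of vertices -/

/-- **THE HUB INEQUALITY FOR ALL TRIPLES OF VERTICES ON TWO-TERMINAL SERIES–PARALLEL SUPPORTS, every `q > 0`** (census g37):
`φ_{w,q}(o ↔ a)·φ_{w,q}(b ↔ a) ≤ φ_{w,q}(o ↔ a ↔ b)` for EVERY `o, a, b : V` once `w` is supported in a two-terminal
series–parallel network `N`. [cite: AyyerLinussonRavichandran2025, §7 eq. (13)–(14), Conj. 7.1 (p. 22)] -/
theorem hubUnder_of_isTTSP_support {q : ℝ} (hq : 0 < q) {N : Finset (Sym2 V)} {x y : V} (hN : IsTTSP N x y)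
    (hw : ∀ e, ((w e : unitInterval) : ℝ) ≠ 0 → e ∈ (↑N : Set (Sym2 V))) (o a b : V) :
    HubUnder (rcMeasureW w q ∅) o a b :=
  hubUnder_of_spGood_support w hq (fun _ _ hE hC _ _ _ => spGoodC_of_isTTSP hN hE hC) hw o a b

/-- **`HubFK`-shaped corollary**: for every `q > 0`, every `n` and every weight vector on `Fin n` supported in a two-terminal
series–parallel network, the hub inequality holds at every triple (the clause of `FK.HubFK q` restricted to such supports).
[cite: AyyerLinussonRavichandran2025, §7 eq. (13)–(14), Conj. 7.1 (p. 22)] -/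
theorem hubFK_of_isTTSP_support {q : ℝ} (hq : 0 < q) (n : ℕ) (w' : Sym2 (Fin n) → unitInterval) {N : Finset (Sym2 (Fin n))}
    {x y : Fin n} (hN : IsTTSP N x y) (hw : ∀ e, ((w' e : unitInterval) : ℝ) ≠ 0 → e ∈ (↑N : Set (Sym2 (Fin n))))
    (o a b : Fin n) : HubUnder (rcMeasureW w' q ∅) o a b :=
  hubUnder_of_isTTSP_support w' hq hN hw o a b

/-- **The sharper correlation for ALL triples on two-terminal series–parallel supports, every `q > 0`**:
`φ(s ↔ t)·φ(b ↔ {s,t}) ≤ φ(Ω)·φ(s ↔ t, b ↔ {s,t})` for every `b, s, t : V`. [cite: AyyerLinussonRavichandran2025, §7 (p. 22)] -/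
theorem real_conn_union_le_of_isTTSP_support {q : ℝ} (hq : 0 < q) {N : Finset (Sym2 V)} {x y : V} (hN : IsTTSP N x y)
    (hw : ∀ e, ((w e : unitInterval) : ℝ) ≠ 0 → e ∈ (↑N : Set (Sym2 V))) (b s t : V) :
    (rcMeasureW w q ∅).real (openConn s t) * (rcMeasureW w q ∅).real (openConn b s ∪ openConn b t) ≤
      (rcMeasureW w q ∅).real univ * (rcMeasureW w q ∅).real (openConn s t ∩ (openConn b s ∪ openConn b t)) :=
  real_conn_union_le_of_spGood_support w hq (fun _ _ hE hC _ _ _ => spGoodC_of_isTTSP hN hE hC) hw b s t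

/-! ### On 2-tree supports (every triple) -/

/-- **THE HUB INEQUALITY FOR ALL TRIPLES ON 2-TREE SUPPORTS, every `q > 0`**: if `w` is supported in a 2-tree `T` (`FK.IsTwoTree`;
the subgraphs of 2-trees are the `K₄`-minor-free graphs, Wald–Colbourn — not formalised), then
`φ_{w,q}(o ↔ a)·φ_{w,q}(b ↔ a) ≤ φ_{w,q}(o ↔ a ↔ b)` for EVERY `o, a, b : V`.  Supersedes the placement hypotheses `oa, ba ∈ T` of
`FK.hubUnder_of_isTwoTree` (`q < 1`) and `FK.hubUnder_of_isTwoTree_of_pos`; via `FK.IsTTSP.of_isTwoTree`.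
[cite: AyyerLinussonRavichandran2025, §7 eq. (13)–(14), Conj. 7.1 (p. 22)] [cite: Wagner2006, §5.3] -/
theorem hubUnder_of_isTwoTree_support {q : ℝ} (hq : 0 < q) {T : Set (Sym2 V)} (hT : IsTwoTree T)
    (hw : ∀ e, ((w e : unitInterval) : ℝ) ≠ 0 → e ∈ T) (o a b : V) : HubUnder (rcMeasureW w q ∅) o a b := by
  obtain ⟨x, y, hxy⟩ : ∃ x y : V, s(x, y) ∈ T := by
    cases hT with
    | @pair u v _ => exact ⟨u, v, Set.mem_singleton _⟩
    | @cons T' u v _ _ huv _ => exact ⟨u, v, Set.mem_union_left _ huv⟩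
  obtain ⟨E, hE, hExy⟩ := IsTTSP.of_isTwoTree hT hxy
  exact hubUnder_of_isTTSP_support w hq hExy (fun e he => by rw [hE]; exact hw e he) o a b

end FK

end Summit.CriticalPhenomena.PercolationContinuityZ3.Theorems
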